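import Literature.NumberTheory.Automorphic.PicardCMPrerequisites
import Literature.AlgebraicGeometry.Motives.VarietiesProjectiveSpaceProofs
import Literature.AlgebraicGeometry.Motives.SegreEmbedding
import Literature.AlgebraicGeometry.HodgeTheory.ClassesSupportedOnComplexification
import HarnessLib

/-!
# A small universe of complex varieties for the Picard–CM period statements: codes of compact
# Picard modular surfaces and of CM abelian varieties, their interpretation by schemes over `ℂ`,
# and the coding of abstract hermitian data

PURPOSE (helper packaging, no mathematical claim of its own). The period statements about compact
Picard modular surfaces and CM abelian varieties are consumed through a "universe of varieties"
record whose index type must be SMALL (`Type`), whereas the tree's `Motives.SchemeOver ℂ` lives in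
`Type 1`. This file supplies

* the small INDEX TYPE `PicardCM.Var`: codes `PicardCode = (E ⊂ ℂ, H, Γ)` — exactly the arithmetic
  binders of conjunct (ii) `PicardCM.BallQuotientAlgebraic` of
  `Literature/NumberTheory/Automorphic/PicardCMPrerequisites.lean`, anisotropy apart —, codes
  `CMCode = (E ⊂ ℂ, Φ)` — the binders of conjunct (iii) `PicardCM.CMAbelianVarietyRealised` —,
  projective spaces `ℙⁿ_ℂ` and binary products;
* its INTERPRETATION `Var.scheme hU h₃ : Var → SchemeOver ℂ` under the two hypotheses
  `hU : BallQuotientUniformisedDatum` (lever (iib-R): the special-cycle-free parent of (ii)), `h₃ : CMAbelianVarietyRealised`, by choice on their existentials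
  made ONCE per code and packaged with everything the records provide (`pmsRealisation`: the surface
  `X`, its smooth projectivity and, on the anisotropic locus, the chosen
  `UnitaryBallQuotientDatum 2 X` with its three identification clauses; `cmRealisation`: the abelian
  variety `AV` (a `Motives.AbelianVariety ℂ`, i.e. a group scheme) with its underlying variety
  `A := AV.X`, the action `ι` of `𝓞_E` by endomorphisms of `AV`, the action `θ` of `E` on
  `H¹(A(ℂ); ℂ)` with `θ(a) = ι(a)^*` on `𝓞_E`, smooth projectivity, `dim H¹ = [E:ℚ]`, the eigenlines
  and their Hodge types — ONE choice, the abelian variety, everything else `choose_spec`); the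
  dimension `Var.dim`, the CONTENT predicates `Var.IsAbelianVariety h₃` / `Var.IsCMAbelianVariety h₃`
  (the scheme of a CM code carries the chosen abelian-variety structure, resp. that structure with
  its `𝓞_E`-action inducing `θ` on `H¹`; closed under products),
  smooth projectivity `Var.isSmoothProjective` (so that every Betti–Hodge construction of the tree
  applies pointwise), rational cohomology `Var.Coh := bettiCohomology ∘ scheme` with its
  finite-dimensionality, morphisms, identities, composition and the projections of a product;
* the CODING of abstract data (`PicardCode.ofHermitian`, `CMCode.ofCMType`): a CM number field `L`
  with a complex embedding `ι₁`, a Gram matrix `Hm ∈ M₃(L)` hermitian for complex conjugation, of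
  signature `(2,1)` at `ι₁` and positive definite at the other complex places, and a torsion-free
  congruence level `Γ ≤ GL₃(L)` are transported along `L ≃+* ι₁(L) ⊂ ℂ`
  (`RingHom.rangeRestrictFieldEquiv`); anisotropy is AUTOMATIC as soon as the code field has a
  complex place other than that of the inclusion (`PicardCode.isAnisotropic_of_ne`: an isotropic
  vector would be isotropic for a positive definite form).

Off the anisotropic locus (imaginary-quadratic `E`, where `Γ\𝔹²` is not compact and (ii) says
nothing) `pmsRealisation` returns the projective plane, so that `Var.scheme` is TOTAL and each of
its values is an honest smooth projective variety of dimension `Var.dim`; `Var.alg` is the honest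
space of rational classes whose complexification is algebraic (`HodgeTheory.algebraicClasses`).
Nothing in this file is cited: the two hypotheses are the tree's records (ii), (iii), and the other
ingredients are theorems of the tree (`Motives.isSmoothProjective_projectiveSpace_holds`,
`Motives.IsSmoothProjective.tensor_holds`, `HodgeTheory.finiteDimensional_bettiCohomology`) and of
Mathlib (`NumberField.of_ringEquiv`, `IsCMField.ofCMExtension`,
`Subgroup.relIndex_map_map_of_injective`).

PLACEMENT (carver RULING P-1, 2026-08-18): this file is PerL-programme PACKAGING — the universe TERM
of the PerL model construction (index type, interpretation, coding), NOT reproduced published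
material; it cites nothing and asserts nothing. Its placement under `Literature/`, beside the records
(ii), (iii) of `PicardCMPrerequisites.lean` that it interprets, is grandfathered by that ruling; it
belongs with the PerL model constructions and migrates with them if a
`Summits/HodgeConjecture/PerL/Model/` gate target opens.
-/

noncomputable section

open NumberField CategoryTheory MonoidalCategory

namespace Literature.NumberTheory.Automorphic

namespace PicardCM

open Literature.AlgebraicGeometry.ShimuraVarieties (hermForm map_hermForm hermForm_starRingEnd
  IsCongruenceSubgroup signatureMatrix conjRingHom embedding_conjRingHom UnitaryBallQuotientDatum
  UnitaryBallUniformisationDatum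
  unitaryGroup mem_unitaryGroup_iff principalCongruenceSubgroup IsCongruentOneMod)
open Literature.AlgebraicGeometry.Motives (SchemeOver ComplexPoints IsSmoothProjective CMType
  AbelianVariety bettiCohomology projectiveSpace isSmoothProjective_projectiveSpace_holds
  ofRatClass_smul)
open Literature.AlgebraicGeometry.HodgeTheory (complexBetti IsOfHodgeType ofRatClass
  algebraicClasses finiteDimensional_bettiCohomology)
open scoped _root_.Matrix ComplexOrder

/-! ### Codes of compact Picard modular surfaces -/

/-- A **Picard code**: the arithmetic input of a Picard modular surface — a CM number field
`E ⊂ ℂ` (embedded by the inclusion), a Gram matrix `H ∈ M₃(E)` hermitian for complex conjugation, of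
signature `(2,1)` at the inclusion and positive definite at every other complex place, and a
torsion-free congruence subgroup `Γ ≤ GL₃(E)` of `U(H)`: the binders of (ii)
`PicardCM.BallQuotientAlgebraic` except anisotropy (a CONSEQUENCE off the imaginary-quadratic
case, `isAnisotropic_of_ne`). [folklore] -/
structure PicardCode : Type where
  /-- The CM field, as a subfield of `ℂ`. -/
  E : Subfield ℂ
  /-- `E` is a number field. -/
  [isNumberField : NumberField E]
  /-- `E` is a CM field. -/
  [isCMField : IsCMField E]
  /-- The Gram matrix of the hermitian form on `E³`. -/
  H : Matrix (Fin 3) (Fin 3) E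
  /-- The arithmetic group. -/
  Γ : Subgroup (GL (Fin 3) E)
  /-- `H` is hermitian: `conj (Hᵢⱼ) = Hⱼᵢ`. -/
  conj_H_apply : ∀ i j, conjRingHom E (H i j) = H j i
  /-- Signature `(2,1)` at the inclusion `E ⊂ ℂ`. -/
  signature : ∃ T : GL (Fin 3) ℂ,
    (T : Matrix (Fin 3) (Fin 3) ℂ)ᴴ * H.map E.subtype * (T : Matrix (Fin 3) (Fin 3) ℂ) =
      signatureMatrix 2
  /-- Positive definite at every complex embedding off the place of the inclusion. -/
  posDef_of_ne : ∀ τ : E →+* ℂ, InfinitePlace.mk τ ≠ InfinitePlace.mk E.subtype → (H.map τ).PosDef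
  /-- `Γ` is a congruence subgroup of `U(H)`. -/
  isCongruenceSubgroup : IsCongruenceSubgroup (conjRingHom E) H Γ
  /-- `Γ` is torsion free. -/
  torsionFree : ∀ γ ∈ Γ, IsOfFinOrder γ → γ = 1

attribute [instance] PicardCode.isNumberField PicardCode.isCMField

namespace PicardCode

/-- The hermitian form of the code is **anisotropic**: `⟪v, v⟫ = 0 → v = 0` on `E³` (the remaining
hypothesis of (ii) `BallQuotientAlgebraic`, equivalent to compactness of `Γ\𝔹²`); a predicate on
codes, not a named fact. [folklore] -/
def IsAnisotropic (c : PicardCode) : Prop :=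
  ∀ v : Fin 3 → c.E, hermForm (conjRingHom c.E) c.H v v = 0 → v = 0

variable (c : PicardCode)

/-- **Anisotropy is automatic off the imaginary-quadratic case**: if `E` has a complex embedding `τ`
defining a place other than that of the inclusion, then `H^τ` is positive definite, so an isotropic
vector `v`, being isotropic at `τ` (`map_hermForm`), vanishes. [folklore] -/
theorem isAnisotropic_of_ne {τ : c.E →+* ℂ}
    (hτ : InfinitePlace.mk τ ≠ InfinitePlace.mk c.E.subtype) : c.IsAnisotropic := by
  intro v hv
  by_contra hne
  have hw : (⇑τ ∘ v : Fin 3 → ℂ) ≠ 0 := by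
    intro h
    apply hne
    funext i
    exact τ.injective (by simpa using congr_fun h i)
  have h1 := map_hermForm τ (embedding_conjRingHom c.E τ) c.H v v
  rw [hv, map_zero, hermForm_starRingEnd] at h1
  have h2 := (c.posDef_of_ne τ hτ).dotProduct_mulVec_pos hw
  rw [← h1] at h2
  exact lt_irrefl _ h2

/-- A code whose field has degree `> 2` is anisotropic: a CM field of degree `> 2` has at least two
complex places. [folklore] -/
theorem isAnisotropic_of_two_lt (h : 2 < Module.finrank ℚ c.E) : c.IsAnisotropic := by
  classical
  by_contra hnot
  -- every embedding defines the place of the inclusion, so there is exactly one infinite place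
  have hall : ∀ τ : c.E →+* ℂ, InfinitePlace.mk τ = InfinitePlace.mk c.E.subtype := by
    intro τ
    by_contra hτ
    exact hnot (c.isAnisotropic_of_ne hτ)
  have hcard : Fintype.card (InfinitePlace c.E) = 1 := by
    rw [Fintype.card_eq_one_iff]
    refine ⟨InfinitePlace.mk c.E.subtype, fun w ↦ ?_⟩
    rw [← InfinitePlace.mk_embedding w]
    exact hall _
  have hrk := IsTotallyComplex.finrank (K := c.E)
  have hc : InfinitePlace.nrComplexPlaces c.E ≤ Fintype.card (InfinitePlace c.E) :=
    Fintype.card_subtype_le _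
  omega

end PicardCode

/-! ### Codes of CM abelian varieties -/

/-- A **CM code**: a CM number field `E ⊂ ℂ` and a CM type `Φ` of `E` (the binders of (iii)
`PicardCM.CMAbelianVarietyRealised`). [folklore] -/
structure CMCode : Type where
  /-- The CM field, as a subfield of `ℂ`. -/
  E : Subfield ℂ
  /-- `E` is a number field. -/
  [isNumberField : NumberField E]
  /-- `E` is a CM field. -/
  [isCMField : IsCMField E]
  /-- The CM type. -/
  Φ : CMType E

attribute [instance] CMCode.isNumberField CMCode.isCMField

/-! ### Realisations: the chosen varieties, packaged with what the records (ii), (iii) provide -/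

/-- A **realisation of a Picard code**: a smooth projective surface `X/ℂ` together with — on the
anisotropic locus — a `UnitaryBallUniformisationDatum 2 X` (uniformisation by `𝔹²`; NO special cycles, lever
(iib-R)) whose field, Gram matrix and group are those of the code (the three identification clauses of (ii-a′)
`BallQuotientUniformisedDatum`). [folklore] -/
structure PMSRealisation (c : PicardCode) where
  /-- The surface. -/
  X : SchemeOver ℂ
  /-- It is a smooth projective surface. -/
  isSmoothProjective : IsSmoothProjective 2 X
  /-- On the anisotropic locus, `X(ℂ) = Γ\𝔹²` (uniformisation datum; no special cycles). -/
  datum : c.IsAnisotropic → UnitaryBallUniformisationDatum 2 X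
  /-- The datum's field is the code's field. -/
  datum_E : ∀ h, (datum h).E = c.E
  /-- The datum's Gram matrix is the code's, read in `ℂ`. -/
  datum_H : ∀ h, ((datum h).H).map (datum h).E.subtype = c.H.map c.E.subtype
  /-- The datum's group is the code's, read in `GL₃(ℂ)`. -/
  datum_Γ : ∀ h, ((datum h).Γ).map
      (Matrix.GeneralLinearGroup.map ((datum h).E.subtype : (datum h).E →+* ℂ)) =
    c.Γ.map (Matrix.GeneralLinearGroup.map (c.E.subtype : c.E →+* ℂ))

open scoped Classical in
/-- **The realisation of a Picard code under (ii-a′)**: on the anisotropic locus the surface and datum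
CHOSEN from `BallQuotientUniformisedDatum` (the `hU`-free parent of `BallQuotientAlgebraic`, lever (iib-R): the
variable keeps its historical name `hU`, its TYPE no longer involves `SpecialCyclesAlgebraic`); elsewhere (imaginary-quadratic `E`, non-compact `Γ\𝔹²`, about
which (ii) says nothing) the projective plane `ℙ²_ℂ`
(`Motives.isSmoothProjective_projectiveSpace_holds`). [folklore] -/
def pmsRealisation (hU : BallQuotientUniformisedDatum) (c : PicardCode) : PMSRealisation c :=
  if h : c.IsAnisotropic then
    { X := (hU c.E c.H c.Γ c.conj_H_apply h c.signature c.posDef_of_ne c.isCongruenceSubgroup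
          c.torsionFree).choose
      isSmoothProjective := (hU c.E c.H c.Γ c.conj_H_apply h c.signature c.posDef_of_ne
          c.isCongruenceSubgroup c.torsionFree).choose_spec.choose.isSmoothProjective
      datum := fun _ ↦ (hU c.E c.H c.Γ c.conj_H_apply h c.signature c.posDef_of_ne
          c.isCongruenceSubgroup c.torsionFree).choose_spec.choose
      datum_E := fun _ ↦ (hU c.E c.H c.Γ c.conj_H_apply h c.signature c.posDef_of_ne
          c.isCongruenceSubgroup c.torsionFree).choose_spec.choose_spec.1
      datum_H := fun _ ↦ (hU c.E c.H c.Γ c.conj_H_apply h c.signature c.posDef_of_ne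
          c.isCongruenceSubgroup c.torsionFree).choose_spec.choose_spec.2.1
      datum_Γ := fun _ ↦ (hU c.E c.H c.Γ c.conj_H_apply h c.signature c.posDef_of_ne
          c.isCongruenceSubgroup c.torsionFree).choose_spec.choose_spec.2.2 }
  else
    { X := projectiveSpace 2 ℂ
      isSmoothProjective := isSmoothProjective_projectiveSpace_holds ℂ 2
      datum := fun h' ↦ (h h').elim
      datum_E := fun h' ↦ (h h').elim
      datum_H := fun h' ↦ (h h').elim
      datum_Γ := fun h' ↦ (h h').elim }

/-- A **realisation of a CM code**: an ABELIAN VARIETY `A/ℂ` (the tree's `Motives.AbelianVariety ℂ`,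
a proper, geometrically integral group scheme over `ℂ`), smooth projective of dimension `g`,
`2g = [E:ℚ]`, with a ring homomorphism `ι : 𝓞_E → End(A)` (endomorphisms of the abelian variety) and
the action `θ` of `E` on `H¹(A(ℂ); ℂ)` with `θ(a) = ι(a)^*` on `𝓞_E`, `dim H¹ = [E:ℚ]`,
one-dimensional `σ`-eigenlines of Hodge type `(1,0)` for `σ ∈ Φ` and `(0,1)` otherwise (the clauses
of (iii) `PicardCM.CMAbelianVarietyRealised`). The underlying scheme is `R.A := R.AV.X` (an `abbrev`,
so every consumer of the former field `A` is unchanged), and the former field `exists_map` is now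
the theorem `CMRealisation.exists_map`. [folklore] -/
structure CMRealisation (c : CMCode) where
  /-- The abelian variety (group scheme over `ℂ`). -/
  AV : AbelianVariety ℂ
  /-- The action of `𝓞_E` by endomorphisms of the abelian variety. -/
  ι : 𝓞 c.E →+* End AV
  /-- The action of `E` on `H¹(A(ℂ); ℂ)`. -/
  θ : c.E →+* Module.End ℂ (complexBetti AV.X 1)
  /-- `A` is a smooth projective variety of dimension `[E:ℚ]/2`. -/
  isSmoothProjective : IsSmoothProjective (Module.finrank ℚ c.E / 2) AV.X
  /-- `dim_ℂ H¹(A(ℂ); ℂ) = [E:ℚ]`. -/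
  finrank_eq : Module.finrank ℂ (complexBetti AV.X 1) = Module.finrank ℚ c.E
  /-- `θ(a) = ι(a)^*` on `H¹` for `a ∈ 𝓞_E`. -/
  map_ι : ∀ a : 𝓞 c.E, (complexBetti.map (ι a).hom.hom.hom 1).hom = θ (a : c.E)
  /-- The `σ`-eigenlines are lines. -/
  finrank_eigenline : ∀ σ : c.E →+* ℂ, Module.finrank ℂ (eigenline θ σ) = 1
  /-- The `σ`-eigenline is of type `(1,0)` for `σ ∈ Φ`. -/
  hodgeType_of_mem : ∀ σ : c.E →+* ℂ, σ ∈ c.Φ.1 →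
    ∀ v ∈ eigenline θ σ, IsOfHodgeType (Module.finrank ℚ c.E / 2) AV.X 1 1 0 v
  /-- The `σ`-eigenline is of type `(0,1)` for `σ ∉ Φ`. -/
  hodgeType_of_not_mem : ∀ σ : c.E →+* ℂ, σ ∉ c.Φ.1 →
    ∀ v ∈ eigenline θ σ, IsOfHodgeType (Module.finrank ℚ c.E / 2) AV.X 1 0 1 v

/-- The underlying scheme over `ℂ` of a realisation (the former field `A`). [folklore] -/
abbrev CMRealisation.A {c : CMCode} (R : CMRealisation c) : SchemeOver ℂ := R.AV.X

/-- `θ(a)` is induced by an endomorphism of `A` for `a ∈ 𝓞_E` (the former field `exists_map`, now a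
consequence of `map_ι`; this is the shape `BettiUniverse.cmEndAction` consumes). [folklore] -/
theorem CMRealisation.exists_map {c : CMCode} (R : CMRealisation c) :
    ∀ a : 𝓞 c.E, ∃ f : R.A ⟶ R.A, (complexBetti.map f 1).hom = R.θ (a : c.E) :=
  fun a ↦ ⟨(R.ι a).hom.hom.hom, R.map_ι a⟩

/-- **The realisation of a CM code under (iii)**, CHOSEN from `CMAbelianVarietyRealised` — ONE
`Classical.choose` (the abelian variety `(A, ι)` of type `(E; Φ)`), everything else `choose_spec`.
[folklore] -/
def cmRealisation (h₃ : CMAbelianVarietyRealised) (c : CMCode) : CMRealisation c where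
  AV := (h₃ c.E c.Φ).choose
  ι := (h₃ c.E c.Φ).choose_spec.choose
  θ := (h₃ c.E c.Φ).choose_spec.choose_spec.choose
  isSmoothProjective := (h₃ c.E c.Φ).choose_spec.choose_spec.choose_spec.1
  finrank_eq := (h₃ c.E c.Φ).choose_spec.choose_spec.choose_spec.2.1
  map_ι := (h₃ c.E c.Φ).choose_spec.choose_spec.choose_spec.2.2.1
  finrank_eigenline := fun σ ↦ ((h₃ c.E c.Φ).choose_spec.choose_spec.choose_spec.2.2.2 σ).1
  hodgeType_of_mem := fun σ ↦ ((h₃ c.E c.Φ).choose_spec.choose_spec.choose_spec.2.2.2 σ).2.1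
  hodgeType_of_not_mem := fun σ ↦ ((h₃ c.E c.Φ).choose_spec.choose_spec.choose_spec.2.2.2 σ).2.2

/-- Restricting the action of a realisation along a field isomorphism `e : K ≃+* E` keeps it
induced by endomorphisms of `A` on `𝓞_K` (`𝓞(e) : 𝓞_K ≃+* 𝓞_E`). [folklore] -/
theorem CMRealisation.exists_map_comp {c : CMCode} (R : CMRealisation c) {K : Type*} [Field K]
    (e : K ≃+* c.E) (a : 𝓞 K) :
    ∃ f : R.A ⟶ R.A, (complexBetti.map f 1).hom = (R.θ.comp e.toRingHom) (a : K) := by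
  obtain ⟨f, hf⟩ := R.exists_map (RingOfIntegers.mapRingEquiv e a)
  exact ⟨f, by rw [hf, RingOfIntegers.mapRingEquiv_apply]; rfl⟩

/-- `dim_ℂ H¹(A(ℂ); ℂ) = 2 · dim A` for the realisation of a CM code (`[E:ℚ]` is even for a CM
field). [folklore] -/
theorem CMRealisation.finrank_eq_two_mul {c : CMCode} (R : CMRealisation c) :
    Module.finrank ℂ (complexBetti R.A 1) = 2 * (Module.finrank ℚ c.E / 2) := by
  rw [R.finrank_eq, IsTotallyComplex.finrank (K := c.E)]
  omega

/-! ### Rational algebraic classes -/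

/-- **Rational algebraic classes** of codimension `p` on `X/ℂ`: the classes in `H²ᵖ(X(ℂ); ℚ)` whose
complexification (`HodgeTheory.ofRatClass`, `a ↦ a ⊗ 1`) lies in the space of algebraic classes
`Nᵖ H²ᵖ(X(ℂ); ℂ)` (`HodgeTheory.algebraicClasses`, the coniveau-`p` part). A `ℚ`-submodule because
`ofRatClass` is additive and `ℚ`-homogeneous (`Motives.ofRatClass_smul`). (Cross-reference: the
tree's `Motives.coniveau X (2 * p) p : Submodule ℚ (bettiCohomology X (2 * p))` is the same space by
flatness of `ℂ/ℚ`; no comparison lemma is stated here, consumers of this file use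
`mem_ratAlgebraicClasses_iff`.) [folklore] -/
def ratAlgebraicClasses (X : SchemeOver ℂ) (p : ℕ) : Submodule ℚ (bettiCohomology X (2 * p)) where
  carrier := {x | ofRatClass (ComplexPoints X) (2 * p) x ∈ algebraicClasses X p}
  add_mem' {x y} hx hy := by
    simp only [Set.mem_setOf_eq, map_add]
    exact add_mem hx hy
  zero_mem' := by
    simp only [Set.mem_setOf_eq, map_zero]
    exact zero_mem _
  smul_mem' q x hx := by
    simp only [Set.mem_setOf_eq, ofRatClass_smul]
    exact Submodule.smul_mem _ _ hx

/-- Membership in the rational algebraic classes. [folklore] -/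
theorem mem_ratAlgebraicClasses_iff (X : SchemeOver ℂ) (p : ℕ) (x : bettiCohomology X (2 * p)) :
    x ∈ ratAlgebraicClasses X p ↔ ofRatClass (ComplexPoints X) (2 * p) x ∈ algebraicClasses X p :=
  Iff.rfl

/-! ### The index type and its interpretation -/

/-- **The small index type of the Picard–CM universe**: compact Picard modular surfaces (by code),
CM abelian varieties (by code), projective spaces `ℙⁿ_ℂ`, and binary products. [folklore] -/
inductive Var : Type
  /-- the Picard modular surface of a code -/
  | pms (c : PicardCode)
  /-- the CM abelian variety of a code -/
  | cm (c : CMCode)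
  /-- projective `n`-space -/
  | proj (n : ℕ)
  /-- the product of two varieties over `ℂ` -/
  | prod (v w : Var)

namespace Var

/-- **Dimension**: `2` for a Picard modular surface, `[E:ℚ]/2` for a CM abelian variety, `n` for
`ℙⁿ`, additive on products. [folklore] -/
def dim : Var → ℕ
  | pms _ => 2
  | cm c => Module.finrank ℚ c.E / 2
  | proj n => n
  | prod v w => v.dim + w.dim

/-- Picard modular surfaces have dimension `2` (by definition of `dim`). [folklore] -/
@[simp] theorem dim_pms (c : PicardCode) : (pms c).dim = 2 := rfl

/-- `dim (cm c) = [E:ℚ]/2` (by definition). [folklore] -/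
@[simp] theorem dim_cm (c : CMCode) : (cm c).dim = Module.finrank ℚ c.E / 2 := rfl

/-- `dim (proj n) = n` (by definition). [folklore] -/
@[simp] theorem dim_proj (n : ℕ) : (proj n).dim = n := rfl

/-- `dim (prod v w) = dim v + dim w` (by definition). [folklore] -/
@[simp] theorem dim_prod (v w : Var) : (prod v w).dim = v.dim + w.dim := rfl

variable (hU : BallQuotientUniformisedDatum) (h₃ : CMAbelianVarietyRealised)

/-- **Abelian varieties of the universe** (CONTENT predicate under (iii)): the scheme of a CM code
carries the abelian-variety structure chosen in `cmRealisation h₃` (a `Motives.AbelianVariety ℂ`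
with that underlying scheme), and products of abelian varieties of the universe; Picard modular
surfaces and projective spaces are not indexed as abelian varieties. (By design this is implied by,
and on atoms coincides with the carrier part of, `IsCMAbelianVariety` below: every abelian variety
the universe indexes is CM; both names are kept because the modelled record has both fields.)
[folklore] -/
def IsAbelianVariety : Var → Prop
  | cm c => ∃ B : AbelianVariety ℂ, B.X = (cmRealisation h₃ c).A
  | prod v w => v.IsAbelianVariety ∧ w.IsAbelianVariety
  | pms _ => False
  | proj _ => False

/-- **CM abelian varieties of the universe** (CONTENT predicate under (iii)): the chosen abelian
variety `(cmRealisation h₃ c).AV` of a CM code `c = (E, Φ)` — whose underlying scheme is the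
universe's variety `scheme (cm c)` — admits an action `ι : 𝓞_E → End` by endomorphisms of the
abelian variety inducing on `H¹` the action `θ` of the realisation (whose `σ`-eigenlines are lines
for all `[E:ℚ] = 2 dim` embeddings `σ`: complex multiplication by `E`), and products of such (a
product of CM abelian varieties is CM). [folklore] -/
def IsCMAbelianVariety : Var → Prop
  | cm c => ∃ ι : 𝓞 c.E →+* End (cmRealisation h₃ c).AV,
      ∀ a : 𝓞 c.E, (complexBetti.map (ι a).hom.hom.hom 1).hom = (cmRealisation h₃ c).θ (a : c.E)
  | prod v w => v.IsCMAbelianVariety ∧ w.IsCMAbelianVariety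
  | pms _ => False
  | proj _ => False


/-- The CM abelian variety of a code IS (indexed as) an abelian variety: the chosen abelian-variety
structure `(cmRealisation h₃ c).AV` has the universe's variety as underlying scheme. [folklore] -/
theorem isAbelianVariety_cm (c : CMCode) : IsAbelianVariety h₃ (cm c) :=
  ⟨(cmRealisation h₃ c).AV, rfl⟩

/-- The CM abelian variety of a code IS (indexed as) a CM abelian variety: the chosen action
`(cmRealisation h₃ c).ι` of `𝓞_E` induces `θ` on `H¹` (`map_ι`). [folklore] -/
theorem isCMAbelianVariety_cm (c : CMCode) : IsCMAbelianVariety h₃ (cm c) :=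
  ⟨(cmRealisation h₃ c).ι, (cmRealisation h₃ c).map_ι⟩

/-- Products: `prod v w` is an abelian variety of the universe iff both factors are (by
definition). [folklore] -/
@[simp] theorem isAbelianVariety_prod (v w : Var) :
    IsAbelianVariety h₃ (prod v w) ↔ IsAbelianVariety h₃ v ∧ IsAbelianVariety h₃ w := Iff.rfl

/-- Products: `prod v w` is a CM abelian variety of the universe iff both factors are (by
definition). [folklore] -/
@[simp] theorem isCMAbelianVariety_prod (v w : Var) :
    IsCMAbelianVariety h₃ (prod v w) ↔ IsCMAbelianVariety h₃ v ∧ IsCMAbelianVariety h₃ w := Iff.rfl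

/-- Picard modular surfaces are not indexed as abelian varieties (by definition). [folklore] -/
@[simp] theorem not_isAbelianVariety_pms (c : PicardCode) : ¬ IsAbelianVariety h₃ (pms c) := id

/-- Projective spaces are not indexed as abelian varieties (by definition). [folklore] -/
@[simp] theorem not_isAbelianVariety_proj (n : ℕ) : ¬ IsAbelianVariety h₃ (proj n) := id

/-- Every CM abelian variety of the universe is an abelian variety of the universe. [folklore] -/
theorem IsCMAbelianVariety.isAbelianVariety :
    ∀ {v : Var}, IsCMAbelianVariety h₃ v → IsAbelianVariety h₃ v
  | cm c, _ => isAbelianVariety_cm h₃ c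
  | prod _ _, h => ⟨h.1.isAbelianVariety, h.2.isAbelianVariety⟩
  | pms _, h => h.elim
  | proj _, h => h.elim


/-- **Interpretation** of the index type by schemes over `ℂ` under (ii) and (iii): the realised
surface, the realised abelian variety, `ℙⁿ_ℂ`, and the product over `Spec ℂ` (the cartesian
monoidal structure of `SchemeOver ℂ`). [folklore] -/
def scheme : Var → SchemeOver ℂ
  | pms c => (pmsRealisation hU c).X
  | cm c => (cmRealisation h₃ c).A
  | proj n => projectiveSpace n ℂ
  | prod v w => scheme v ⊗ scheme w

/-- The scheme of `pms c` is the realising surface (by definition). [folklore] -/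
@[simp] theorem scheme_pms (c : PicardCode) : scheme hU h₃ (pms c) = (pmsRealisation hU c).X := rfl

/-- The scheme of `cm c` is the realising abelian variety (by definition). [folklore] -/
@[simp] theorem scheme_cm (c : CMCode) : scheme hU h₃ (cm c) = (cmRealisation h₃ c).A := rfl

/-- The scheme of `proj n` is `ℙⁿ_ℂ` (by definition). [folklore] -/
@[simp] theorem scheme_proj (n : ℕ) : scheme hU h₃ (proj n) = projectiveSpace n ℂ := rfl

/-- The scheme of a product is the fibre product over `ℂ` (by definition). [folklore] -/
@[simp] theorem scheme_prod (v w : Var) :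
    scheme hU h₃ (prod v w) = (scheme hU h₃ v ⊗ scheme hU h₃ w) := rfl

/-- **Every variety of the universe is smooth projective of dimension `dim`** (the records for the
codes; `isSmoothProjective_projectiveSpace_holds`; `IsSmoothProjective.tensor_holds`). [folklore] -/
theorem isSmoothProjective : ∀ v : Var, IsSmoothProjective v.dim (scheme hU h₃ v)
  | pms c => (pmsRealisation hU c).isSmoothProjective
  | cm c => (cmRealisation h₃ c).isSmoothProjective
  | proj n => isSmoothProjective_projectiveSpace_holds ℂ n
  | prod v w => Literature.AlgebraicGeometry.Motives.IsSmoothProjective.tensor_holds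
      (isSmoothProjective v) (isSmoothProjective w)

/-- **Rational cohomology** `Hᵏ(X(ℂ); ℚ)` of a variety of the universe: the tree's Betti cohomology
of its interpretation (a small type). [folklore] -/
abbrev Coh (v : Var) (k : ℕ) : Type := bettiCohomology (scheme hU h₃ v) k

/-- **Algebraic classes** of a variety of the universe: the rational algebraic classes of its
interpretation (`ratAlgebraicClasses`). [folklore] -/
abbrev alg (v : Var) (p : ℕ) : Submodule ℚ (Coh hU h₃ v (2 * p)) :=
  ratAlgebraicClasses (scheme hU h₃ v) p

/-- `Hᵏ(X(ℂ); ℚ)` is finite-dimensional (`finiteDimensional_bettiCohomology`). [folklore] -/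
theorem finite (v : Var) (k : ℕ) : Module.Finite ℚ (Coh hU h₃ v k) :=
  finiteDimensional_bettiCohomology (isSmoothProjective hU h₃ v) k

/-- **Morphisms** between varieties of the universe: `ℂ`-morphisms of their interpretations (a small
type). [folklore] -/
abbrev Mor (v w : Var) : Type := scheme hU h₃ v ⟶ scheme hU h₃ w

/-- The identity morphism. [folklore] -/
abbrev idMor (v : Var) : Mor hU h₃ v v := 𝟙 _

/-- Composition of morphisms (diagrammatic order). [folklore] -/
abbrev comp {u v w : Var} (f : Mor hU h₃ u v) (g : Mor hU h₃ v w) : Mor hU h₃ u w := f ≫ g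

/-- The first projection of a product. [folklore] -/
abbrev fst (v w : Var) : Mor hU h₃ (prod v w) v := CartesianMonoidalCategory.fst _ _

/-- The second projection of a product. [folklore] -/
abbrev snd (v w : Var) : Mor hU h₃ (prod v w) w := CartesianMonoidalCategory.snd _ _

/-- On the anisotropic locus, the Picard modular surface of a code carries the chosen
`UnitaryBallUniformisationDatum 2` (uniformisation by `𝔹²`; no special cycles, lever (iib-R)). [folklore] -/
abbrev ballDatum (c : PicardCode) (h : c.IsAnisotropic) :
    UnitaryBallUniformisationDatum 2 (scheme hU h₃ (pms c)) :=
  (pmsRealisation hU c).datum h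

/-- The CM action on `H¹` of the CM abelian variety of a code. [folklore] -/
abbrev cmTheta (c : CMCode) : c.E →+* Module.End ℂ (complexBetti (scheme hU h₃ (cm c)) 1) :=
  (cmRealisation h₃ c).θ

end Var

/-! ### Coding abstract hermitian data and CM types by subfields of `ℂ` -/

section Coding

variable {L : Type} [Field L] [NumberField L] [IsCMField L] (ι₁ : L →+* ℂ)

/-- The code field `ι₁(L) ⊂ ℂ` is a number field (`NumberField.of_ringEquiv` along
`L ≃+* ι₁(L)`). [folklore] -/
instance numberField_fieldRange : NumberField ι₁.fieldRange :=
  NumberField.of_ringEquiv (e := ι₁.rangeRestrictFieldEquiv)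

/-- The code field `ι₁(L) ⊂ ℂ` of a CM field is a CM field (`isTotallyComplex_of_algebra` and
`IsCMField.ofCMExtension` along `L ≃+* ι₁(L)`). [folklore] -/
instance isCMField_fieldRange : IsCMField ι₁.fieldRange := by
  let e : L ≃+* ι₁.fieldRange := ι₁.rangeRestrictFieldEquiv
  letI : Algebra L ι₁.fieldRange := e.toRingHom.toAlgebra
  haveI : IsTotallyComplex ι₁.fieldRange := isTotallyComplex_of_algebra L _
  letI alg : Algebra (maximalRealSubfield L) ι₁.fieldRange :=
    (e.toRingHom.comp (algebraMap (maximalRealSubfield L) L)).toAlgebra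
  let e' : L ≃ₐ[maximalRealSubfield L] ι₁.fieldRange :=
    AlgEquiv.ofRingEquiv (f := e) (fun _ ↦ rfl)
  haveI : Algebra.IsQuadraticExtension (maximalRealSubfield L) ι₁.fieldRange :=
    ⟨by rw [← e'.toLinearEquiv.finrank_eq, Algebra.IsQuadraticExtension.finrank_eq_two]⟩
  exact IsCMField.ofCMExtension (maximalRealSubfield L) _

/-- The coding equivalence intertwines the complex conjugations (both are read off `ℂ` through
`ι₁`: `IsCMField.complexEmbedding_complexConj`). [folklore] -/
theorem conjRingHom_rangeRestrictFieldEquiv (x : L) :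
    conjRingHom ι₁.fieldRange (ι₁.rangeRestrictFieldEquiv x) =
      ι₁.rangeRestrictFieldEquiv (IsCMField.complexConj L x) := by
  apply Subtype.ext
  have h1 :=
    embedding_conjRingHom ι₁.fieldRange ι₁.fieldRange.subtype (ι₁.rangeRestrictFieldEquiv x)
  have h2 := IsCMField.complexEmbedding_complexConj L ι₁ x
  simp only [Subfield.coe_subtype] at h1
  rw [h1]
  change starRingEnd ℂ (ι₁ x) = ι₁ (IsCMField.complexConj L x)
  exact h2.symm

end Coding

/-! ### Transport of unitary and congruence groups along a field isomorphism -/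

section Transport

variable {L E : Type*} [Field L] [Field E] (e : L ≃+* E) {σL : L →+* L} {σE : E →+* E}
  (hσ : ∀ x, σE (e x) = e (σL x)) {m : Type*} [Fintype m] [DecidableEq m] (Hm : Matrix m m L)

omit [Fintype m] [DecidableEq m] in
include hσ in
/-- `(M.map e).map σE = (M.map σL).map e` when `σE ∘ e = e ∘ σL`. [folklore] -/
theorem map_map_conj (M : Matrix m m L) : (M.map e).map σE = (M.map σL).map e := by
  ext i j
  simp [hσ]

/-- `Matrix.map` along a ring isomorphism commutes with the triple products met in isometry
conditions. [folklore] -/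
theorem map_transpose_mul_mul (A B C : Matrix m m L) :
    (A.map e)ᵀ * B.map e * C.map e = (Aᵀ * B * C).map e := by
  change _ = e.mapMatrix _
  rw [map_mul, map_mul]
  simp only [RingEquiv.mapMatrix_apply, Matrix.transpose_map]

/-- `GL.map e ∘ GL.map e⁻¹ = id`. [folklore] -/
theorem glMap_glMap_symm (g' : GL m E) :
    Matrix.GeneralLinearGroup.map e.toRingHom (Matrix.GeneralLinearGroup.map e.symm.toRingHom g') =
      g' :=
  Matrix.GeneralLinearGroup.ext fun i j ↦ by
    rw [Matrix.GeneralLinearGroup.map_apply, Matrix.GeneralLinearGroup.map_apply]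
    exact e.apply_symm_apply _

/-- `GL.map e⁻¹ ∘ GL.map e = id`. [folklore] -/
theorem glMap_symm_glMap (g : GL m L) :
    Matrix.GeneralLinearGroup.map e.symm.toRingHom (Matrix.GeneralLinearGroup.map e.toRingHom g) =
      g :=
  Matrix.GeneralLinearGroup.ext fun i j ↦ by
    rw [Matrix.GeneralLinearGroup.map_apply, Matrix.GeneralLinearGroup.map_apply]
    exact e.symm_apply_apply _

/-- `GL.map e` is injective for a ring isomorphism `e`. [folklore] -/
theorem glMap_injective :
    Function.Injective (Matrix.GeneralLinearGroup.map (n := m) e.toRingHom) :=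
  Function.LeftInverse.injective (glMap_symm_glMap e)

include hσ in
/-- A field isomorphism intertwining the involutions carries `U(Hm)` onto `U(Hm^e)`. [folklore] -/
theorem mem_unitaryGroup_map_iff (g : GL m L) :
    Matrix.GeneralLinearGroup.map e.toRingHom g ∈ unitaryGroup σE (Hm.map e) ↔
      g ∈ unitaryGroup σL Hm := by
  rw [mem_unitaryGroup_iff, mem_unitaryGroup_iff]
  have hcoe : ((Matrix.GeneralLinearGroup.map e.toRingHom g : GL m E) : Matrix m m E) =
      (g : Matrix m m L).map e := rfl
  rw [hcoe, map_map_conj e hσ, map_transpose_mul_mul]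
  exact e.mapMatrix.injective.eq_iff

omit [DecidableEq m] in
/-- `algebraMap 𝓞_E E ∘ 𝓞(e) = e ∘ algebraMap 𝓞_L L`. [folklore] -/
theorem algebraMap_mapRingEquiv (a : 𝓞 L) :
    algebraMap (𝓞 E) E (RingOfIntegers.mapRingEquiv e a) = e (algebraMap (𝓞 L) L a) :=
  RingOfIntegers.mapRingEquiv_apply e a

omit [Fintype m] in
/-- `g ≡ 1 (mod n)` integrally is preserved by a field isomorphism (which carries `𝓞_L` onto
`𝓞_E`, `NumberField.RingOfIntegers.mapRingEquiv`). [folklore] -/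
theorem IsCongruentOneMod.map_ringEquiv {n : ℕ}
    {g : Matrix m m L} (h : IsCongruentOneMod n g) : IsCongruentOneMod n (g.map e) := by
  obtain ⟨A, rfl⟩ := h
  refine ⟨A.map (RingOfIntegers.mapRingEquiv e), ?_⟩
  ext i j
  simp only [Matrix.map_apply, Matrix.add_apply, Matrix.smul_apply, map_add, map_nsmul,
    algebraMap_mapRingEquiv, Matrix.one_apply, apply_ite e, map_one, map_zero]

omit [Fintype m] in
/-- `g ≡ 1 (mod n)` integrally is invariant under a field isomorphism. [folklore] -/
theorem isCongruentOneMod_map_iff (n : ℕ) (g : Matrix m m L) :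
    IsCongruentOneMod n (g.map e) ↔ IsCongruentOneMod n g := by
  refine ⟨fun h ↦ ?_, IsCongruentOneMod.map_ringEquiv e⟩
  have h' := IsCongruentOneMod.map_ringEquiv e.symm h
  simp only [Matrix.map_map] at h'
  convert h'
  ext i j
  simp

include hσ in
/-- The principal congruence subgroups correspond under a field isomorphism intertwining the
involutions. [folklore] -/
theorem map_principalCongruenceSubgroup (n : ℕ) :
    (principalCongruenceSubgroup σL Hm n).map (Matrix.GeneralLinearGroup.map e.toRingHom) =
      principalCongruenceSubgroup σE (Hm.map e) n := by
  ext g'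
  constructor
  · rintro ⟨g, hg, rfl⟩
    refine ⟨(mem_unitaryGroup_map_iff e hσ Hm g).mpr hg.1, ?_, ?_⟩
    · exact (isCongruentOneMod_map_iff e n (g : Matrix m m L)).mpr hg.2.1
    · rw [← map_inv]
      exact (isCongruentOneMod_map_iff e n ((g⁻¹ : GL m L) : Matrix m m L)).mpr hg.2.2
  · intro hg'
    refine ⟨Matrix.GeneralLinearGroup.map e.symm.toRingHom g', ⟨?_, ?_, ?_⟩, glMap_glMap_symm e g'⟩
    · apply (mem_unitaryGroup_map_iff e hσ Hm _).mp
      rw [glMap_glMap_symm]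
      exact hg'.1
    · apply (isCongruentOneMod_map_iff e n _).mp
      change IsCongruentOneMod n ((Matrix.GeneralLinearGroup.map e.toRingHom
        (Matrix.GeneralLinearGroup.map e.symm.toRingHom g') : GL m E) : Matrix m m E)
      rw [glMap_glMap_symm]
      exact hg'.2.1
    · apply (isCongruentOneMod_map_iff e n _).mp
      change IsCongruentOneMod n ((Matrix.GeneralLinearGroup.map e.toRingHom
        (Matrix.GeneralLinearGroup.map e.symm.toRingHom g')⁻¹ : GL m E) : Matrix m m E)
      rw [map_inv, glMap_glMap_symm]
      exact hg'.2.2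

include hσ in
/-- **Congruence subgroups are preserved** by a field isomorphism intertwining the involutions:
`Γ ↦ e(Γ)` (isometries to isometries, `Γ(n) ↦ Γ(n)`, finite index by
`Subgroup.relIndex_map_map_of_injective`). [folklore] -/
theorem isCongruenceSubgroup_map {Γ : Subgroup (GL m L)}
    (hΓ : IsCongruenceSubgroup σL Hm Γ) :
    IsCongruenceSubgroup σE (Hm.map e) (Γ.map (Matrix.GeneralLinearGroup.map e.toRingHom)) := by
  obtain ⟨hle, n, hn, hΓn, hfi⟩ := hΓ
  refine ⟨?_, n, hn, ?_, ?_⟩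
  · rintro _ ⟨g, hg, rfl⟩
    exact (mem_unitaryGroup_map_iff e hσ Hm g).mpr (hle hg)
  · rw [← map_principalCongruenceSubgroup e hσ Hm n]
    exact Subgroup.map_mono hΓn
  · rw [← map_principalCongruenceSubgroup e hσ Hm n]
    constructor
    change ((principalCongruenceSubgroup σL Hm n).map _).relIndex (Γ.map _) ≠ 0
    rw [Subgroup.relIndex_map_map_of_injective _ _ (glMap_injective e)]
    exact hfi.index_ne_zero

/-- **Torsion-freeness is preserved** by a field isomorphism. [folklore] -/
theorem torsionFree_map {Γ : Subgroup (GL m L)}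
    (hΓ : ∀ γ ∈ Γ, IsOfFinOrder γ → γ = 1) :
    ∀ γ ∈ Γ.map (Matrix.GeneralLinearGroup.map e.toRingHom), IsOfFinOrder γ → γ = 1 := by
  rintro _ ⟨g, hg, rfl⟩ hfin
  rw [hΓ g hg (((glMap_injective e).isOfFinOrder_iff).mp hfin), map_one]

omit [DecidableEq m] in
include hσ in
/-- **Transport of the hermitian form** along a ring isomorphism intertwining the involutions:
`⟪e ∘ u, e ∘ v⟫_{Hm^e} = e ⟪u, v⟫_{Hm}`. [folklore] -/
theorem hermForm_map_ringEquiv (u v : m → L) :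
    hermForm σE (Hm.map e.toRingHom) (e ∘ u) (e ∘ v) = e (hermForm σL Hm u v) := by
  simp only [hermForm, dotProduct, Matrix.mulVec, Function.comp_apply, map_sum, map_mul, hσ,
    Matrix.map_apply, RingEquiv.toRingHom_eq_coe, RingHom.coe_coe]

omit [DecidableEq m] in
include hσ in
/-- **Anisotropy is invariant under transport** along a ring isomorphism intertwining the
involutions. [folklore] -/
theorem anisotropic_map_ringEquiv_iff :
    (∀ v : m → E, hermForm σE (Hm.map e.toRingHom) v v = 0 → v = 0) ↔
      ∀ v : m → L, hermForm σL Hm v v = 0 → v = 0 := by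
  constructor
  · intro h v hv
    have h1 : hermForm σE (Hm.map e.toRingHom) (e ∘ v) (e ∘ v) = 0 := by
      rw [hermForm_map_ringEquiv e hσ Hm, hv, map_zero]
    funext i
    simpa using congrFun (h _ h1) i
  · intro h v hv
    have h1 : hermForm σL Hm (e.symm ∘ v) (e.symm ∘ v) = 0 := by
      apply e.injective
      rw [← hermForm_map_ringEquiv e hσ Hm, map_zero]
      have : (e ∘ (e.symm ∘ v) : m → E) = v := by funext i; simp
      rw [this, hv]
    funext i
    simpa using congrFun (h _ h1) i

end Transport

/-! ### The code of abstract hermitian data -/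

namespace PicardCode

variable {L : Type} [Field L] [NumberField L] [IsCMField L] (ι₁ : L →+* ℂ)
  (Hm : Matrix (Fin 3) (Fin 3) L) (Γ : Subgroup (GL (Fin 3) L))

/-- **The Picard code of abstract hermitian data** `(L, ι₁, Hm, Γ)`: field `ι₁(L) ⊂ ℂ`, Gram matrix
and group transported along `e = ι₁.rangeRestrictFieldEquiv : L ≃+* ι₁(L)`; the hypotheses —
hermitian for `IsCMField.complexConj L`, signature `(2,1)` at `ι₁`, positive definite at the
embeddings off the place of `ι₁`, `Γ` a torsion-free congruence subgroup — transported with them.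
[folklore] -/
def ofHermitian
    (hHerm : ∀ i j, (IsCMField.complexConj L).toRingEquiv.toRingHom (Hm i j) = Hm j i)
    (hSig : ∃ T : GL (Fin 3) ℂ,
      (T : Matrix (Fin 3) (Fin 3) ℂ)ᴴ * Hm.map ι₁ * (T : Matrix (Fin 3) (Fin 3) ℂ) =
        signatureMatrix 2)
    (hPos : ∀ τ : L →+* ℂ, InfinitePlace.mk τ ≠ InfinitePlace.mk ι₁ → (Hm.map τ).PosDef)
    (hCong : IsCongruenceSubgroup (IsCMField.complexConj L).toRingEquiv.toRingHom Hm Γ)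
    (hTf : ∀ γ ∈ Γ, IsOfFinOrder γ → γ = 1) : PicardCode where
  E := ι₁.fieldRange
  H := Hm.map ι₁.rangeRestrictFieldEquiv
  Γ := Γ.map (Matrix.GeneralLinearGroup.map ι₁.rangeRestrictFieldEquiv.toRingHom)
  conj_H_apply i j := by
    simp only [Matrix.map_apply]
    rw [conjRingHom_rangeRestrictFieldEquiv]
    exact congrArg _ (hHerm i j)
  signature := by
    have hmap : (Hm.map ι₁.rangeRestrictFieldEquiv).map ι₁.fieldRange.subtype = Hm.map ι₁ := by
      ext i j; rfl
    rw [hmap]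
    exact hSig
  posDef_of_ne τ hτ := by
    have hmap : (Hm.map ι₁.rangeRestrictFieldEquiv).map τ =
        Hm.map (τ.comp ι₁.rangeRestrictFieldEquiv.toRingHom) := by
      ext i j; rfl
    rw [hmap]
    apply hPos
    intro heq
    apply hτ
    have hι : InfinitePlace.mk (ι₁.fieldRange.subtype.comp ι₁.rangeRestrictFieldEquiv.toRingHom) =
        InfinitePlace.mk ι₁ :=
      congrArg InfinitePlace.mk (RingHom.ext fun x ↦ rfl)
    rw [← hι] at heq
    rcases InfinitePlace.mk_eq_iff.mp heq with h | h
    · have : τ = ι₁.fieldRange.subtype := by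
        ext x
        have := RingHom.congr_fun h (ι₁.rangeRestrictFieldEquiv.symm x)
        simpa using this
      rw [this]
    · apply InfinitePlace.mk_eq_iff.mpr
      right
      ext x
      have := RingHom.congr_fun h (ι₁.rangeRestrictFieldEquiv.symm x)
      simpa [ComplexEmbedding.conjugate] using this
  isCongruenceSubgroup :=
    isCongruenceSubgroup_map ι₁.rangeRestrictFieldEquiv
      (σL := (IsCMField.complexConj L).toRingEquiv.toRingHom)
      (fun x ↦ conjRingHom_rangeRestrictFieldEquiv ι₁ x) Hm hCong
  torsionFree := torsionFree_map ι₁.rangeRestrictFieldEquiv hTf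

/-- The code field of `ofHermitian` is `ι₁(L)`. [folklore] -/
@[simp] theorem ofHermitian_E (hHerm hSig hPos hCong hTf) :
    (ofHermitian ι₁ Hm Γ hHerm hSig hPos hCong hTf).E = ι₁.fieldRange := rfl

/-- The Gram matrix of `ofHermitian`, read in `ℂ`, is `Hm^{ι₁}`. [folklore] -/
theorem ofHermitian_H_map (hHerm hSig hPos hCong hTf) :
    (ofHermitian ι₁ Hm Γ hHerm hSig hPos hCong hTf).H.map ι₁.fieldRange.subtype = Hm.map ι₁ := by
  ext i j; rfl

/-- The group of `ofHermitian`, read in `GL₃(ℂ)`, is `ι₁(Γ)`. [folklore] -/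
theorem ofHermitian_Γ_map (hHerm hSig hPos hCong hTf) :
    (ofHermitian ι₁ Hm Γ hHerm hSig hPos hCong hTf).Γ.map
        (Matrix.GeneralLinearGroup.map (ι₁.fieldRange.subtype : ι₁.fieldRange →+* ℂ)) =
      Γ.map (Matrix.GeneralLinearGroup.map ι₁) := by
  change (Γ.map _).map _ = _
  rw [Subgroup.map_map, ← Matrix.GeneralLinearGroup.map_comp]
  rfl

/-- **The code of hermitian data over a CM field of degree `> 2` is anisotropic** (so (ii) applies
to it): `[ι₁(L):ℚ] = [L:ℚ] > 2`. [folklore] -/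
theorem isAnisotropic_ofHermitian (hHerm hSig hPos hCong hTf) (hL : 2 < Module.finrank ℚ L) :
    (ofHermitian ι₁ Hm Γ hHerm hSig hPos hCong hTf).IsAnisotropic := by
  apply isAnisotropic_of_two_lt
  change 2 < Module.finrank ℚ ι₁.fieldRange
  rwa [← (AlgEquiv.ofRingEquiv (f := ι₁.rangeRestrictFieldEquiv)
    (fun q ↦ by simp) : L ≃ₐ[ℚ] ι₁.fieldRange).toLinearEquiv.finrank_eq]

/-- **Anisotropy of the code of hermitian data is anisotropy of the data**:
`(ofHermitian ι₁ Hm Γ …).IsAnisotropic ↔ ∀ v, ⟪v, v⟫_{Hm} = 0 → v = 0` (for the CM conjugation of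
`L`), by transport along `ι₁.rangeRestrictFieldEquiv`. [folklore] -/
theorem isAnisotropic_ofHermitian_iff (hHerm hSig hPos hCong hTf) :
    (ofHermitian ι₁ Hm Γ hHerm hSig hPos hCong hTf).IsAnisotropic ↔
      ∀ v : Fin 3 → L,
        hermForm (IsCMField.complexConj L).toRingEquiv.toRingHom Hm v v = 0 → v = 0 :=
  anisotropic_map_ringEquiv_iff ι₁.rangeRestrictFieldEquiv
    (σL := (IsCMField.complexConj L).toRingEquiv.toRingHom)
    (fun x ↦ conjRingHom_rangeRestrictFieldEquiv ι₁ x) Hm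

end PicardCode

namespace CMCode

/-- Transport of a CM type along a field isomorphism: `Φ ↦ {σ | σ ∘ e ∈ Φ}`. [folklore] -/
def cmTypeMap {L E : Type} [Field L] [Field E] (e : L ≃+* E) (Φ : CMType L) : CMType E :=
  ⟨{σ | σ.comp e.toRingHom ∈ Φ.1}, fun σ ↦ by
    have h := Φ.2 (σ.comp e.toRingHom)
    have hc : ComplexEmbedding.conjugate (σ.comp e.toRingHom) =
        (ComplexEmbedding.conjugate σ).comp e.toRingHom := rfl
    rw [hc] at h
    exact h⟩

/-- Membership in the transported CM type. [folklore] -/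
@[simp] theorem mem_cmTypeMap_iff {L E : Type} [Field L] [Field E] (e : L ≃+* E) (Φ : CMType L)
    (σ : E →+* ℂ) : σ ∈ (cmTypeMap e Φ).1 ↔ σ.comp e.toRingHom ∈ Φ.1 := Iff.rfl

variable {L : Type} [Field L] [NumberField L] [IsCMField L]

/-- **The CM code of an abstract CM type** `(L, Φ)` at a chosen complex embedding `ι : L →+* ℂ`:
field `ι(L) ⊂ ℂ`, type transported along `ι.rangeRestrictFieldEquiv`. [folklore] -/
def ofCMType (ι : L →+* ℂ) (Φ : CMType L) : CMCode where
  E := ι.fieldRange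
  Φ := cmTypeMap ι.rangeRestrictFieldEquiv Φ

/-- The code field of `ofCMType` is `ι(L)`. [folklore] -/
@[simp] theorem ofCMType_E (ι : L →+* ℂ) (Φ : CMType L) : (ofCMType ι Φ).E = ι.fieldRange := rfl

/-- `σ : ι(L) →+* ℂ` lies in the code's CM type iff `σ ∘ e ∈ Φ`. [folklore] -/
theorem mem_ofCMType_Φ_iff (ι : L →+* ℂ) (Φ : CMType L) (σ : ι.fieldRange →+* ℂ) :
    σ ∈ (ofCMType ι Φ).Φ.1 ↔ σ.comp ι.rangeRestrictFieldEquiv.toRingHom ∈ Φ.1 := Iff.rfl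

/-- `[ι(L):ℚ] = [L:ℚ]`, so the CM abelian variety of the code has dimension `[L:ℚ]/2`. [folklore] -/
theorem finrank_ofCMType_E (ι : L →+* ℂ) (Φ : CMType L) :
    Module.finrank ℚ (ofCMType ι Φ).E = Module.finrank ℚ L := by
  change Module.finrank ℚ ι.fieldRange = _
  rw [← (AlgEquiv.ofRingEquiv (f := ι.rangeRestrictFieldEquiv)
    (fun q ↦ by simp) : L ≃ₐ[ℚ] ι.fieldRange).toLinearEquiv.finrank_eq]

end CMCode

end PicardCM

end Literature.NumberTheory.Automorphic

end
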